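import Literature.Barriers.CriticalPhenomena.SupercriticalSAWSpaceFillingNarrow
import Literature.Probability.RandomPlanarGeometry.ChordalCurveFamily
import Literature.Probability.RandomPlanarGeometry.SAWSideProbability
import Mathlib.Analysis.Convex.PathConnected
import HarnessLib

/-!
# Barrier mechanism, audited: the space-filling obstruction of Duminil-Copin–Kozma–Yadin sees
# the law of the TRACE only — in the curve topology it is exactly "limits are a.s. onto the
# domain", and it is blind to initial segments (Loewner prefixes, driving functions)

Barrier catalogue `Literature/Barriers/CriticalPhenomena/` (D-0021); second audit (2026-08-15,
refuter, "barrier-audit" gen 2) of `SupercriticalSAWSpaceFilling`, aimed at its mechanism file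
`…Proofs` (`SupercriticalSAW.IsSpaceFillingFamily.not_convergesInLawToSLE`: a weakly
space-filling family of SAW laws does not converge in law to a random curve missing a ball with
positive probability). The barrier itself is Theorem 1 of H. Duminil-Copin, G. Kozma, A. Yadin,
*Supercritical self-avoiding walks are space-filling*, Ann. IHP Probab. Stat. 50 (2014) 315–326,
arXiv:1110.3074 — PROVED in the tree (`SupercriticalSAWSpaceFilling_holds`, `…TilesTheorem6`),
its `blocks:` line is the theorem `SupercriticalSAWSpaceFilling.not_robustSAWScalingLimit`
(`…Refutation`), and the first audit (`SupercriticalSAWSpaceFillingNarrow`) narrowed the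
technique class along the FUGACITY axis (δ-independent neighbourhoods only; hypotheses open in
`x` are fine). Outcome of this audit: **mechanism confirmed and sharpened; technique class
narrowed along a second axis — the TOPOLOGY / TIME ORDER of the conclusion.**

## What the audit found

1. **Confirmed, and the exact reach (proved).** The mechanism is a one-sided portmanteau
   argument with the bounded Lipschitz functionals `F_{z,r}(c) = g_r(dist(z, trace c))`; it uses
   nothing about SLE except that the limit misses a ball with positive probability, and nothing
   about the lattice except that the trace of `γ_δ` misses a fixed ball with probability `→ 0`.
   Run over countably many balls it gives the sharp statement
   (`SupercriticalSAW.ae_subset_range_of_tendstoLaw`): *whatever a weakly space-filling family of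
   random curves converges to in law, in the curve topology, is almost surely ONTO the open set
   it fills* — so the obstruction applies to convergence to ANY random curve that is not a.s.
   onto `D` (`SupercriticalSAW.IsSpaceFillingLaws.not_convergesInLawToSLE_of_not_ae_onto`): every
   chordal SLE_κ with `κ < 8` ("for `κ < 8` the Hausdorff dimension of `γ[0,∞)` is a.s. bounded
   above by `1 + κ/8`", Rohde–Schramm, arXiv p. 19, Cor. 25 = Thm 8.1 of the Annals version;
   equality by Beffara), and no SLE_κ with `κ ≥ 8` (space-filling, RS05 abstract p. 2 and §7),
   matching Conjecture 11 of the source (SLE₈ for `x > 1/μ`, p. 8). The same functional is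
   `1`-Lipschitz for the Hausdorff distance of traces, so the weaker `d_H`-convergence of
   Lawler–Schramm–Werner ("proofs of convergence using the weaker metric `d_H` would be
   interesting", arXiv p. 13, §3.4.1) is obstructed as well. The hypothesis `hW` of the `…Proofs`
   lemmas is now a theorem (`isProjectiveLimit_preWienerMeasure_holds`).
2. **Narrowed: the conclusion of Theorem 1 is a statement about the law of the final trace and
   is blind to initial segments (proved).** The printed weak space-filling property ("for any
   open set `U ⊂ Ω`, `P[γ_δ ∩ U = ∅] → 0`", p. 2) and the hole-size event of Theorem 1 are
   functions of the unordered range of `γ_δ`. The filling surgery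
   `SupercriticalSAW.exists_fillingSurgery` — run a curve at double speed, then append an
   `ε`-dense loop at its endpoint inside a star-shaped compact set — preserves the initial
   segment up to the first visit of EVERY set the curve visits (`Curve.stopAt`, exactly, as
   parametrised curves: `SupercriticalSAW.stopAt_eq_of_prefix`) and makes the trace `ε`-dense.
   Applied to the SAW polylines of `𝔻_δ` with `ε = δ` (`SupercriticalSAW.prefixBlind_unitDisk`):
   under ANY family of laws on SAWs — e.g. the critical laws `lawAt x_c` — the modified curves
   are surely space-filling at scale `δ` (miss probabilities of every ball `B(z,r) ⊆ 𝔻` are `0`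
   for `δ < r`) while all their stopped-prefix laws are those of the SAW. Hence NO statement
   about initial segments can be refuted by the conclusion of Theorem 1. This matters because
   the chordal Loewner chain of a curve in `(D; a, b)` up to half-plane capacity `T < ∞` is a
   functional of the curve stopped at `B̄(b, ρ)` for small `ρ` (finite capacity = bounded away
   from `b`): fugacity-robust statements about DRIVING FUNCTIONS on compact time intervals —
   equivalently Carathéodory convergence of the chains (Lawler 2005, §4.7, Prop. 4.47), a
   topology in which every chain whatsoever is a limit of chains of simple curves (Prop. 4.48) —
   or about martingale observables evaluated before disconnection, or about local (finitely many
   steps) limits at the starting point, are NOT obstructed by Theorem 1. Upgrading driving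
   convergence to curve convergence is exactly what needs an extra crossing estimate ("The major
   technical problem … is how to deduce the strong convergence of interfaces from some weaker
   notions … first to prove the convergence of the driving process … and then improve it to
   convergence of curves", Kemppainen–Smirnov, arXiv p. 3, §1; Cor. 1.5, p. 5), and that
   estimate fails for space-filling families (the UST Peano curve "fails to satisfy Condition
   G", §4.5, p. 28). On the time structure of the supercritical walk the source is explicit:
   "We know that the curve becomes space-filling, yet we have very little additional
   information" (p. 8, §4). What WOULD obstruct `x`-robust driving-level statements is
   Conjecture 11 itself (SLE₈ has driving function `√8 B ≠ √(8/3) B`) or any "progressive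
   filling" theorem for `x > 1/μ` — none is in print (27 citing works checked, `lit citing`).
3. **Scope: fugacity ensembles only.** The canonical formulations carry no fugacity at all: the
   half-plane infinite SAW is the weak limit of UNIFORM measures on `n`-step walks (LSW, arXiv
   p. 14, §3.4.6; existence p. 18, Appendix), its SLE_{8/3} limit is Prediction 1 (p. 17, §4.1),
   and the connective constant enters only through Kesten's relation `Σ λ_n β^{-n} = 1` (p. 18)
   — exactly, once. Routes through the kinetic/canonical ensemble meet the barrier only in a
   final equivalence-of-ensembles step.
4. **Scope, the other side of `x_c` (confirming).** The source calls the subcritical geodesic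
   picture expected "though we are not aware of a reference for the details" (p. 2); one exists
   at thesis level: for `x < 1/μ` (`α > log μ`) the walk between opposite ends of a box "converges
   to a straight line … Actually … to a Brownian Bridge. These results are implicit in the works
   [Chayes–Chayes 1986, Ioffe 1998] and have been worked out by Y. Kovchegov in his thesis"
   (Betz–Taggi, arXiv:1612.07234, p. 2, §1). A straight segment is not an SLE_{8/3} curve, so
   LEFT-neighbourhood-robust SLE_{8/3} conclusions are refuted too (box domains; no journal
   reference treats a general Dobrushin domain) — the two-sidedness of `RobustSAWScalingLimit`
   is not where its weakness lies.

## Formal content (all proved; one new closed `Prop`, `SupercriticalSAWSpaceFillingProofsNarrow`)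

Range side for any measurable random curve class (`measurableSet_disjoint_ball_range`,
`integral_missFunctional_comp_le`, `le_of_missProfile_eq_zero`,
`infDist_le_of_missFunctional_eq_zero`); the sharp mechanism
(`ae_infDist_range_le_of_tendstoLaw`, `ae_subset_range_of_tendstoLaw`,
`not_tendstoLaw_of_not_ae_subset_range`, `not_ae_subset_range_of_measure_ne_zero` — the old
`hmiss` is a special case); SAW/SLE specialisations
(`IsSpaceFillingLaws.tendsto_measure_disjoint_ball`, `IsSpaceFillingLaws.ae_carrier_subset_range`,
`IsSpaceFillingLaws.not_convergesInLawToSLE_of_not_ae_onto`). Surgery: `tour`,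
`mem_range_tour`, `range_tour_subset`, `exists_loop_range_dense`, `curvePath`, `appendLoop`
(`_apply_of_le`, `source_`, `target_`, `range_`), `hitParam_eq_half_of_prefix`,
`stopAt_eq_of_prefix`, `exists_fillingSurgery`, `polylineCurve` (`curve_eq_mk_polylineCurve`,
`source_`, `target_`), `exists_prefixPreserving_filling_unitDisk`, `prefixBlind_unitDisk`; the
narrowed barrier `SupercriticalSAWSpaceFillingProofsNarrow` with `…_holds`.

Mathlib: `Path.segment`, `Path.trans`, `Path.trans_apply`, `Path.trans_range`, `Path.cast`,
`finite_cover_balls_of_compact`, `StarConvex.segment_subset`, `csInf_union`,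
`Set.projIcc_of_mem`, `TopologicalSpace.exists_countable_dense`, `Dense.exists_dist_lt`,
`MeasureTheory.ae_all_iff`, `integral_eq_zero_iff_of_nonneg_ae`, `measure_eq_zero_iff_ae_notMem`.

## References (page-level, audit 2026-08-15; pages of the arXiv versions)

* H. Duminil-Copin, G. Kozma, A. Yadin, Ann. IHP Probab. Stat. 50 (2014) 315–326,
  arXiv:1110.3074: p. 2 (§1: weak sense of space-filling; "It should be the Schramm-Löwner
  Evolution of parameter 8"; Theorem 1), p. 3 (Theorem 2; "we will not make this restriction"
  to `d = 2`), p. 8 (§4: "We know that the curve becomes space-filling, yet we have very little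
  additional information"; Problems 9–10; Conjecture 11). [DuminilCopinKozmaYadin2014]
* G. F. Lawler, O. Schramm, W. Werner, *On the scaling limit of planar self-avoiding walk*,
  arXiv:math/0204277: pp. 12–13 §3.4.1 (metrics `d_H ≤ d`; "proofs of convergence using the
  weaker metric `d_H` would be interesting"), p. 14 §3.4.6 and p. 18 Appendix (half-plane
  infinite SAW as a weak limit of uniform measures; Kesten's relation), p. 17 §4.1 Prediction 1.
  [LawlerSchrammWerner2004SAW]
* G. F. Lawler, *Conformally invariant processes in the plane*, AMS (2005): §4.7, Prop. 4.47
  (driving convergence ⇒ Carathéodory convergence of chordal chains), Prop. 4.48 (every chain is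
  a Carathéodory limit of chains generated by simple curves). [Lawler2005]
* A. Kemppainen, S. Smirnov, *Random curves, scaling limits and Loewner evolutions*, Ann.
  Probab. 45 (2017), arXiv:1212.6215: p. 3 §1 (two routes: driving process first, then
  upgrade), p. 5 Cor. 1.5 (under Condition G driving and curve convergence are equivalent),
  p. 28 §4.5 (Condition G fails for the UST Peano curve). [KemppainenSmirnov2017]
* V. Betz, L. Taggi, *Scaling limit of a self-avoiding walk interacting with spatial random
  permutations*, Electron. J. Probab. 24 (2019), arXiv:1612.07234: p. 2 §1 (subcritical
  step-weighted SAW between opposite ends of a box converges to a straight line / Brownian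
  bridge; Chayes–Chayes, Ioffe, Kovchegov's thesis 2002). [BetzTaggi2016]
* S. Rohde, O. Schramm, *Basic properties of SLE*, Ann. of Math. 161 (2005), arXiv:math/0106036:
  p. 2 (phases; space-filling for `κ > 8`), p. 19 Cor. 25 (= Thm 8.1: `dim γ[0,∞) ≤ 1 + κ/8` for
  `κ < 8`). [RohdeSchramm2005]  V. Beffara, Ann. Probab. 36 (2008), Thm 1 (equality). [Beffara2008]
-/

noncomputable section

open MeasureTheory Filter Topology Metric Set Literature.Probability.LatticeModels
  Literature.Probability.Percolation Literature.Probability.RandomPlanarGeometry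
  Literature.Probability.RandomPlanarGeometry.SAW
open scoped ENNReal NNReal BoundedContinuousFunction unitInterval

namespace Literature.Barriers.CriticalPhenomena

namespace SupercriticalSAW


/-! ### The test functional vanishes only on curves meeting the closed ball -/

section Profile

variable {E : Type*} [MetricSpace E]

/-- `g_r(t) = 0` forces `t ≤ r` (`r > 0`). [folklore] -/
theorem le_of_missProfile_eq_zero {r t : ℝ} (hr : 0 < r) (h : missProfile r t = 0) : t ≤ r := by
  by_contra hlt
  push Not at hlt
  have h1 : 0 < t / r - 1 := by
    rw [sub_pos, lt_div_iff₀ hr, one_mul]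
    exact hlt
  have h2 : 0 < missProfile r t := lt_min zero_lt_one (h1.trans_le (le_max_right _ _))
  exact h2.ne' h

/-- `F_{z,r}(c) = 0` forces `dist(z, trace c) ≤ r` (`r > 0`). [folklore] -/
theorem infDist_le_of_missFunctional_eq_zero {z : E} {r : ℝ} (hr : 0 < r) {c : CurveClass E}
    (h : missFunctional z r c = 0) : infDist z c.range ≤ r :=
  le_of_missProfile_eq_zero hr (by rwa [missFunctional_apply] at h)

end Profile

/-! ### Range form of the lattice side: any family of random curve classes -/

section RangeSide

variable {E : Type*} [MetricSpace E] {α : Type*} [MeasurableSpace α]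

/-- The event "the trace misses the open ball `B(z, r)`" is the preimage of a closed set of curve
classes, hence measurable for a measurable random curve class. [folklore] -/
theorem measurableSet_disjoint_ball_range {X : α → CurveClass E} (hX : Measurable X) (z : E) (r : ℝ) :
    MeasurableSet {a | Disjoint (ball z r) (X a).range} := by
  have : {a | Disjoint (ball z r) (X a).range} = X ⁻¹' CurveClass.rangeSubset (ball z r)ᶜ := by
    ext a
    simp only [mem_setOf_eq, mem_preimage, CurveClass.mem_rangeSubset, subset_compl_iff_disjoint_left]
  rw [this]
  exact hX (CurveClass.measurableSet_rangeSubset isOpen_ball.isClosed_compl)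

/-- **Range form of the lattice side of the portmanteau step**: for a finite measure `μ` and a
measurable random curve class `X`, `∫ F_{z,r}(X) dμ ≤ μ[trace X misses B(z, r)]` (`F_{z,r}`
vanishes on a curve meeting `B(z, r)` and is at most `1`). [folklore] -/
theorem integral_missFunctional_comp_le (μ : Measure α) [IsFiniteMeasure μ] {X : α → CurveClass E}
    (hX : Measurable X) {z : E} {r : ℝ} (hr : 0 < r) :
    ∫ a, missFunctional z r (X a) ∂μ ≤ (μ {a | Disjoint (ball z r) (X a).range}).toReal := by
  set S : Set α := {a | Disjoint (ball z r) (X a).range}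
  have hS : MeasurableSet S := measurableSet_disjoint_ball_range hX z r
  rw [← measureReal_def, ← integral_indicator_one hS]
  refine integral_mono ?_ ((integrable_const (1 : ℝ)).indicator hS) fun a => ?_
  · exact Integrable.of_bound
      ((missFunctional z r).continuous.measurable.comp hX).aestronglyMeasurable 1
      (ae_of_all _ fun a => by
        rw [Real.norm_eq_abs, abs_of_nonneg (missFunctional_nonneg _ _ _)]
        exact missFunctional_le_one _ _ _)
  · by_cases ha : a ∈ S
    · rw [indicator_of_mem ha, Pi.one_apply]
      exact missFunctional_le_one _ _ _
    · rw [indicator_of_notMem ha]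
      have ha' : ∃ y ∈ (X a).range, y ∈ ball z r := by
        by_contra hcon
        push Not at hcon
        exact ha (Set.disjoint_left.2 fun y hy hy' => hcon y hy' hy)
      obtain ⟨y, hy, hyz⟩ := ha'
      exact (missFunctional_eq_zero hr hy (mem_ball.1 hyz)).le

end RangeSide

/-! ### The limit of a weakly space-filling family is almost surely onto the domain -/

section Onto

variable {E : Type*} [MetricSpace E] {Ωδ : ℝ → Type*} [∀ δ, MeasurableSpace (Ωδ δ)]
  {X : ∀ δ, Ωδ δ → CurveClass E} {P : ∀ δ, Measure (Ωδ δ)} {Ω' : Type*} [MeasurableSpace Ω']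
  {W : Measure Ω'} {Γ : Ω' → CurveClass E}

/-- **One ball.** If `X δ → Γ` in law (bounded continuous test functions on curve classes), the
`P δ` are finite, `W` is finite, and the traces of `X δ` miss the ball `B(z, r)` with probability
`→ 0`, then almost surely the trace of `Γ` comes within distance `r` of `z`: by portmanteau with
the test functional `F_{z,r}`, `∫ F_{z,r}(Γ) dW = lim ∫ F_{z,r}(X δ) dP δ = 0`. [folklore] -/
theorem ae_infDist_range_le_of_tendstoLaw [∀ δ, IsFiniteMeasure (P δ)] [IsFiniteMeasure W]
    (hX : ∀ δ, Measurable (X δ)) (hΓ : AEMeasurable Γ W) (hT : TendstoLaw X P Γ W)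
    {z : E} {r : ℝ} (hr : 0 < r)
    (hz : Tendsto (fun δ => P δ {ω | Disjoint (ball z r) (X δ ω).range}) (𝓝[>] 0) (𝓝 0)) :
    ∀ᵐ ω ∂W, infDist z (Γ ω).range ≤ r := by
  have hlim : Tendsto (fun δ => ∫ ω, missFunctional z r (X δ ω) ∂P δ) (𝓝[>] (0 : ℝ))
      (𝓝 (∫ ω, missFunctional z r (Γ ω) ∂W)) := hT (missFunctional z r)
  have hu : Tendsto (fun δ => (P δ {ω | Disjoint (ball z r) (X δ ω).range}).toReal)
      (𝓝[>] (0 : ℝ)) (𝓝 0) := by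
    have h := (ENNReal.tendsto_toReal ENNReal.zero_ne_top).comp hz
    rwa [ENNReal.toReal_zero] at h
  have hzero : Tendsto (fun δ => ∫ ω, missFunctional z r (X δ ω) ∂P δ) (𝓝[>] (0 : ℝ)) (𝓝 0) :=
    tendsto_of_tendsto_of_tendsto_of_le_of_le tendsto_const_nhds hu
      (fun δ => integral_nonneg fun ω => missFunctional_nonneg _ _ _)
      (fun δ => integral_missFunctional_comp_le (P δ) (hX δ) hr)
  have hL : ∫ ω, missFunctional z r (Γ ω) ∂W = 0 := tendsto_nhds_unique hlim hzero
  have hint : Integrable (fun ω => missFunctional z r (Γ ω)) W :=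
    Integrable.of_bound
      ((missFunctional z r).continuous.measurable.comp_aemeasurable hΓ).aestronglyMeasurable 1
      (ae_of_all _ fun ω => by
        rw [Real.norm_eq_abs, abs_of_nonneg (missFunctional_nonneg _ _ _)]
        exact missFunctional_le_one _ _ _)
  have hae : (fun ω => missFunctional z r (Γ ω)) =ᵐ[W] 0 :=
    (integral_eq_zero_iff_of_nonneg_ae (ae_of_all _ fun ω => missFunctional_nonneg _ _ _) hint).1 hL
  filter_upwards [hae] with ω hω
  exact infDist_le_of_missFunctional_eq_zero hr hω

/-- **The limit in law of a weakly space-filling family of random curves is almost surely ONTO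
the open set it fills.** If `X δ → Γ` in law in the curve topology, and for every ball
`B(z, r) ⊆ Ω` the traces of `X δ` miss `B(z, r)` with probability `→ 0` (the range form of the
weak space-filling property of Duminil-Copin–Kozma–Yadin §1), then `W`-almost surely
`Ω ⊆ trace Γ`. Countably many balls (centres in a countable dense set, radii `1/(n+1)`) and the
compactness of traces. This is the exact content of the mechanism of the barrier in the curve
topology: whatever such a family converges to is a space-filling curve. [cite: DuminilCopinKozmaYadin2014, §1 (When x > 1/μ)] -/
theorem ae_subset_range_of_tendstoLaw [TopologicalSpace.SeparableSpace E]
    [∀ δ, IsFiniteMeasure (P δ)] [IsFiniteMeasure W]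
    (hX : ∀ δ, Measurable (X δ)) (hΓ : AEMeasurable Γ W) (hT : TendstoLaw X P Γ W)
    {Ω : Set E} (hΩ : IsOpen Ω)
    (hfill : ∀ (z : E) (r : ℝ), 0 < r → ball z r ⊆ Ω →
      Tendsto (fun δ => P δ {ω | Disjoint (ball z r) (X δ ω).range}) (𝓝[>] 0) (𝓝 0)) :
    ∀ᵐ ω ∂W, Ω ⊆ (Γ ω).range := by
  obtain ⟨Dd, hDc, hDd⟩ := TopologicalSpace.exists_countable_dense E
  -- the countable family of test balls
  haveI : Countable ↥(Dd ∩ Ω) := (hDc.mono inter_subset_left).to_subtype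
  have hball : ∀ (q : ↥(Dd ∩ Ω)) (n : ℕ), ∀ᵐ ω ∂W,
      ball (q : E) (1 / ((n : ℝ) + 1)) ⊆ Ω → infDist (q : E) (Γ ω).range ≤ 1 / ((n : ℝ) + 1) := by
    intro q n
    by_cases hq : ball (q : E) (1 / ((n : ℝ) + 1)) ⊆ Ω
    · filter_upwards [ae_infDist_range_le_of_tendstoLaw hX hΓ hT (by positivity) (hfill _ _ (by positivity) hq)]
        with ω hω _ using hω
    · exact ae_of_all _ fun ω h => absurd h hq
  have hall : ∀ᵐ ω ∂W, ∀ (q : ↥(Dd ∩ Ω)) (n : ℕ),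
      ball (q : E) (1 / ((n : ℝ) + 1)) ⊆ Ω → infDist (q : E) (Γ ω).range ≤ 1 / ((n : ℝ) + 1) := by
    rw [ae_all_iff]
    intro q
    rw [ae_all_iff]
    exact hball q
  filter_upwards [hall] with ω hω
  intro z hz
  -- `z` is in the closure of the (closed) trace
  rw [← (Γ ω).isCompact_range.isClosed.closure_eq, Metric.mem_closure_iff]
  intro ε hε
  obtain ⟨ρ, hρ, hρΩ⟩ := Metric.isOpen_iff.1 hΩ z hz
  set ρ' : ℝ := min (ρ / 2) (ε / 2) with hρ'
  have hρ'pos : 0 < ρ' := lt_min (by linarith) (by linarith)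
  obtain ⟨q, hqD, hzq⟩ := hDd.exists_dist_lt z hρ'pos
  have hqΩ : q ∈ Ω := hρΩ (mem_ball'.2 (hzq.trans_le ((min_le_left _ _).trans (by linarith))))
  obtain ⟨n, hn⟩ := exists_nat_one_div_lt hρ'pos
  have hsub : ball q (1 / ((n : ℝ) + 1)) ⊆ Ω := by
    refine Subset.trans ?_ hρΩ
    intro y hy
    rw [mem_ball] at hy ⊢
    calc dist y z ≤ dist y q + dist q z := dist_triangle _ _ _
      _ < 1 / ((n : ℝ) + 1) + ρ' := by rw [dist_comm q z]; exact add_lt_add hy hzq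
      _ ≤ ρ' + ρ' := by linarith
      _ ≤ ρ := by linarith [min_le_left (ρ / 2) (ε / 2)]
  have hq := hω ⟨q, hqD, hqΩ⟩ n hsub
  have hlt : infDist q (Γ ω).range < ρ' := hq.trans_lt hn
  obtain ⟨y, hy, hqy⟩ := (infDist_lt_iff (Γ ω).range_nonempty).1 hlt
  refine ⟨y, hy, ?_⟩
  calc dist z y ≤ dist z q + dist q y := dist_triangle _ _ _
    _ < ρ' + ρ' := add_lt_add hzq hqy
    _ ≤ ε := by linarith [min_le_right (ρ / 2) (ε / 2)]

/-- **The mechanism in its sharp form.** Under the hypotheses of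
`ae_subset_range_of_tendstoLaw` except convergence: if `Γ` is NOT almost surely onto `Ω`, the
family does not converge in law to `Γ`. [cite: DuminilCopinKozmaYadin2014, §1 (When x > 1/μ)] -/
theorem not_tendstoLaw_of_not_ae_subset_range [TopologicalSpace.SeparableSpace E]
    [∀ δ, IsFiniteMeasure (P δ)] [IsFiniteMeasure W]
    (hX : ∀ δ, Measurable (X δ)) (hΓ : AEMeasurable Γ W) {Ω : Set E} (hΩ : IsOpen Ω)
    (hfill : ∀ (z : E) (r : ℝ), 0 < r → ball z r ⊆ Ω →
      Tendsto (fun δ => P δ {ω | Disjoint (ball z r) (X δ ω).range}) (𝓝[>] 0) (𝓝 0))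
    (hnot : ¬ ∀ᵐ ω ∂W, Ω ⊆ (Γ ω).range) : ¬ TendstoLaw X P Γ W :=
  fun hT => hnot (ae_subset_range_of_tendstoLaw hX hΓ hT hΩ hfill)

/-- A curve missing a ball `B(z, 2r)` with `B(z, r) ⊆ Ω` with positive probability is not almost
surely onto `Ω`: the hypothesis `hmiss` of `IsSpaceFillingFamily.not_convergesInLawToSLE`
(`…Proofs`) is a special case of "not a.s. onto". [folklore] -/
theorem not_ae_subset_range_of_measure_ne_zero {Ω : Set E} {z : E} {r : ℝ} (hr : 0 < r)
    (hball : ball z r ⊆ Ω) (hpos : W {ω | Disjoint (ball z (2 * r)) (Γ ω).range} ≠ 0) :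
    ¬ ∀ᵐ ω ∂W, Ω ⊆ (Γ ω).range := by
  intro h
  apply hpos
  rw [measure_eq_zero_iff_ae_notMem]
  filter_upwards [h] with ω hω hdis
  have hz : z ∈ (Γ ω).range := hω (hball (mem_ball_self hr))
  exact Set.disjoint_left.1 hdis (mem_ball_self (by linarith)) hz

end Onto

/-! ### Specialisation to SAW laws and to SLE -/

section SAWLaws

variable {κ : ℝ≥0} {D : DobrushinDomain} {A B : ℝ → Site 2}
  {P : ∀ δ : ℝ, Measure (DomainSAW D.carrier δ (A δ) (B δ))}

/-- For SAW laws the mesh-point form of the weak space-filling property (`IsSpaceFillingLaws`,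
the printed "γ_δ ∩ U = ∅" read on visited sites) implies the range form for the polylines: a
polyline missing a ball visits no mesh point in it. [cite: DuminilCopinKozmaYadin2014, §1 (When x > 1/μ)] -/
theorem IsSpaceFillingLaws.tendsto_measure_disjoint_ball (hfill : IsSpaceFillingLaws D.carrier A B P)
    {z : ℂ} {r : ℝ} (hr : 0 < r) (hball : ball z r ⊆ D.carrier) :
    Tendsto (fun δ => P δ {γ | Disjoint (ball z r) (DomainSAW.curve γ).range}) (𝓝[>] 0) (𝓝 0) := by
  refine tendsto_of_tendsto_of_tendsto_of_le_of_le tendsto_const_nhds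
    (hfill (ball z r) isOpen_ball hball ⟨z, mem_ball_self hr⟩) (fun _ => bot_le) fun δ => ?_
  refine measure_mono fun γ hγ v hv hvz => ?_
  exact Set.disjoint_left.1 hγ hvz (meshPoint_mem_range_curve γ hv)

/-- **Limits of weakly space-filling SAW laws are a.s. onto the domain**: if the (finite) laws
`P δ` on the SAWs of `Ω_δ` from `A δ` to `B δ` are space-filling in `Ω = D.carrier` in the weak
sense of §1 and the polylines converge in law (curve topology) to a random curve class `Γ` under
a finite measure `W`, then `W`-a.s. `Ω ⊆ trace Γ`. [cite: DuminilCopinKozmaYadin2014, §1 (When x > 1/μ)] -/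
theorem IsSpaceFillingLaws.ae_carrier_subset_range [∀ δ, IsFiniteMeasure (P δ)]
    (hfill : IsSpaceFillingLaws D.carrier A B P) {Ω' : Type*} [MeasurableSpace Ω']
    {W : Measure Ω'} [IsFiniteMeasure W] {Γ : Ω' → CurveClass ℂ} (hΓ : AEMeasurable Γ W)
    (hT : TendstoLaw (fun δ (γ : DomainSAW D.carrier δ (A δ) (B δ)) => γ.curve) P Γ W) :
    ∀ᵐ ω ∂W, D.carrier ⊆ (Γ ω).range :=
  ae_subset_range_of_tendstoLaw (fun _ => DomainSAW.measurable_of_top _) hΓ hT D.isOpen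
    fun _ _ hr hball => hfill.tendsto_measure_disjoint_ball hr hball

/-- **The barrier mechanism, sharp form, for SLE_κ with any `κ`**: if the SAW laws `P δ` are
weakly space-filling in `D` and NO chordal SLE_κ random curve in `(D; a, b)` is almost surely
onto `D` (true for every `κ < 8`: the trace has dimension `1 + κ/8 < 2`; false for `κ ≥ 8`), then
the polylines do not converge in law to chordal SLE_κ. The hypothesis `hmiss` of
`IsSpaceFillingLaws.not_convergesInLawToSLE` is the special case
`not_ae_subset_range_of_measure_ne_zero`; the pre-Wiener measure is a probability measure
unconditionally (`isProjectiveLimit_preWienerMeasure_holds`). [cite: DuminilCopinKozmaYadin2014, §1 and Conjecture 11] -/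
theorem IsSpaceFillingLaws.not_convergesInLawToSLE_of_not_ae_onto [∀ δ, IsFiniteMeasure (P δ)]
    (hfill : IsSpaceFillingLaws D.carrier A B P)
    (hκ : ∀ Γ : (ℝ≥0 → ℝ) → CurveClass ℂ, IsSLECurve κ D Γ →
      ¬ ∀ᵐ ω ∂Literature.Probability.Process.preWienerMeasure, D.carrier ⊆ (Γ ω).range) :
    ¬ ConvergesInLawToSLE κ D (fun δ (γ : DomainSAW D.carrier δ (A δ) (B δ)) => γ.curve) P := by
  haveI := Literature.Probability.Process.isProbabilityMeasure_preWienerMeasure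
    isProjectiveLimit_preWienerMeasure_holds
  rintro ⟨Γ, hΓ, -, hT⟩
  exact hκ Γ hΓ (hfill.ae_carrier_subset_range hΓ.aemeasurable hT)

end SAWLaws



/-! ### A dense loop in a star-shaped compact set -/

section Tour

variable {E : Type*} [AddCommGroup E] [Module ℝ E] [TopologicalSpace E] [ContinuousAdd E]
  [ContinuousSMul ℝ E]

/-- The star tour based at `b` through the points of a list: out along the segment `[b, q]` and
back, for each `q` in turn. [folklore] -/
def tour (b : E) : List E → Path b b
  | [] => Path.refl b
  | q :: L => ((Path.segment b q).trans (Path.segment q b)).trans (tour b L)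

/-- The star tour visits every point of the list. [folklore] -/
theorem mem_range_tour (b : E) : ∀ {L : List E} {q : E}, q ∈ L → q ∈ Set.range (tour b L)
  | [], _, hq => absurd hq List.not_mem_nil
  | p :: L, q, hq => by
    rw [tour, Path.trans_range, Path.trans_range, Path.range_segment, Path.range_segment]
    rcases List.mem_cons.1 hq with rfl | h
    · exact Or.inl (Or.inl (right_mem_segment ℝ b q))
    · exact Or.inr (mem_range_tour b h)

/-- The star tour stays in any set star-convex at `b` containing `b` and the points of the
list. [folklore] -/
theorem range_tour_subset {b : E} {K : Set E} (hK : StarConvex ℝ b K) (hb : b ∈ K) :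
    ∀ {L : List E}, (∀ q ∈ L, q ∈ K) → Set.range (tour b L) ⊆ K
  | [], _ => by
    rw [tour]
    rintro _ ⟨t, rfl⟩
    exact hb
  | p :: L, hL => by
    rw [tour, Path.trans_range, Path.trans_range, Path.range_segment, Path.range_segment]
    have hp : p ∈ K := hL p List.mem_cons_self
    refine union_subset (union_subset (hK.segment_subset hp) ?_)
      (range_tour_subset hK hb fun q hq => hL q (List.mem_cons_of_mem _ hq))
    rw [segment_symm]
    exact hK.segment_subset hp

end Tour

/-- **An `ε`-dense loop.** In a compact set `K` star-convex at `b ∈ K` (e.g. the closed unit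
disk, any `b` in it) there is, for every `ε > 0`, a loop at `b` inside `K` passing within `ε` of
every point of `K` (a star tour through a finite `ε`-net). [folklore] -/
theorem exists_loop_range_dense {E : Type*} [NormedAddCommGroup E] [NormedSpace ℝ E] {K : Set E}
    (hK : IsCompact K) {b : E} (hb : b ∈ K) (hKb : StarConvex ℝ b K) {ε : ℝ} (hε : 0 < ε) :
    ∃ p : Path b b, Set.range p ⊆ K ∧ ∀ z ∈ K, ∃ y ∈ Set.range p, dist z y < ε := by
  obtain ⟨t, htK, htfin, hcover⟩ := finite_cover_balls_of_compact hK hε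
  refine ⟨tour b htfin.toFinset.toList, range_tour_subset hKb hb fun q hq => htK ?_, fun z hz => ?_⟩
  · simpa using hq
  · obtain ⟨x, hx, hzx⟩ := mem_iUnion₂.1 (hcover hz)
    exact ⟨x, mem_range_tour b (by simpa using hx), mem_ball.1 hzx⟩

/-! ### Appending a loop at the end of a curve; the first half is the original curve -/

section Append

variable {E : Type*} [TopologicalSpace E]

/-- A curve as a Mathlib path between its endpoints. [folklore] -/
def curvePath (γ : Curve E) : Path γ.source γ.target where
  toContinuousMap := γ.toContinuousMap
  source' := rfl
  target' := rfl

/-- `curvePath` has the same values as the curve. [folklore] -/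
@[simp] theorem curvePath_apply (γ : Curve E) (t : I) : curvePath γ t = γ t := rfl

/-- **Append a loop at the endpoint**: the curve `γ` run at double speed on `[0, 1/2]`, followed
by the loop `p` (based at `γ.target`) on `[1/2, 1]`. [folklore] -/
def appendLoop (γ : Curve E) (p : Path γ.target γ.target) : Curve E :=
  Curve.ofPath ((curvePath γ).trans p)

/-- On the first half of the parameter interval the appended curve IS `γ` (at double speed).
[folklore] -/
theorem appendLoop_apply_of_le (γ : Curve E) (p : Path γ.target γ.target) {t : I}
    (ht : (t : ℝ) ≤ 1 / 2) :
    appendLoop γ p t = γ ⟨2 * t, (unitInterval.mul_pos_mem_iff zero_lt_two).2 ⟨t.2.1, ht⟩⟩ := by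
  rw [appendLoop, Curve.ofPath_apply, Path.trans_apply, dif_pos ht, curvePath_apply]

/-- The appended curve starts where `γ` starts. [folklore] -/
@[simp] theorem source_appendLoop (γ : Curve E) (p : Path γ.target γ.target) :
    (appendLoop γ p).source = γ.source :=
  Curve.source_ofPath _

/-- The appended curve ends where `γ` ends. [folklore] -/
@[simp] theorem target_appendLoop (γ : Curve E) (p : Path γ.target γ.target) :
    (appendLoop γ p).target = γ.target :=
  Curve.target_ofPath _

/-- The trace of the appended curve is the union of the two traces. [folklore] -/
theorem range_appendLoop (γ : Curve E) (p : Path γ.target γ.target) :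
    (appendLoop γ p).range = γ.range ∪ Set.range p := by
  change Set.range ⇑((curvePath γ).trans p) = Set.range ⇑γ ∪ Set.range ⇑p
  rw [Path.trans_range]
  rfl

/-- **The first hitting parameter halves.** If `γ'` runs through `γ` at double speed on
`[0, 1/2]` and `γ` visits `F`, then the first hitting parameter of `F` by `γ'` is half that of
`γ`. [folklore] -/
theorem hitParam_eq_half_of_prefix {γ γ' : Curve E}
    (h : ∀ t : I, ∀ ht : (t : ℝ) ≤ 1 / 2, γ' t = γ ⟨2 * t, (unitInterval.mul_pos_mem_iff zero_lt_two).2 ⟨t.2.1, ht⟩⟩)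
    {F : Set E} (hF : ∃ t, γ t ∈ F) : γ'.hitParam F = γ.hitParam F / 2 := by
  -- the genuine visiting parameters of `γ`
  set A₀ : Set ℝ := {t : ℝ | ∃ ht : t ∈ I, γ ⟨t, ht⟩ ∈ F} with hA₀
  have hA₀ne : A₀.Nonempty := by
    obtain ⟨t, ht⟩ := hF
    exact ⟨t, t.2, by simpa using ht⟩
  have hA₀bdd : BddBelow A₀ := ⟨0, fun t ht => ht.1.1⟩
  have hA₀le : ∀ t ∈ A₀, t ≤ 1 := fun t ht => ht.1.2
  have hγ : γ.hitParam F = sInf A₀ := by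
    change sInf (A₀ ∪ {1}) = sInf A₀
    rw [csInf_union hA₀bdd hA₀ne (bddBelow_singleton) (singleton_nonempty 1), csInf_singleton]
    obtain ⟨t, ht⟩ := hA₀ne
    exact min_eq_left ((csInf_le hA₀bdd ht).trans (hA₀le t ht))
  have hT0 : 0 ≤ sInf A₀ := le_csInf hA₀ne fun t ht => ht.1.1
  have hT1 : sInf A₀ ≤ 1 := by
    obtain ⟨t, ht⟩ := hA₀ne
    exact (csInf_le hA₀bdd ht).trans (hA₀le t ht)
  rw [hγ]
  -- the hit set of `γ'`
  have hne' : (γ'.hitSet F).Nonempty := ⟨1, γ'.one_mem_hitSet F⟩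
  have hbdd' : BddBelow (γ'.hitSet F) := ⟨0, fun s hs => (γ'.hitSet_subset_Icc F hs).1⟩
  apply le_antisymm
  · -- every `t ∈ A₀` gives the visit `t / 2` of `γ'`
    have key : ∀ t ∈ A₀, γ'.hitParam F ≤ t / 2 := by
      rintro t ⟨htI, htF⟩
      have ht2 : t / 2 ∈ I := ⟨by linarith [htI.1], by linarith [htI.2]⟩
      refine csInf_le hbdd' (Or.inl ⟨ht2, ?_⟩)
      have hle : ((⟨t / 2, ht2⟩ : I) : ℝ) ≤ 1 / 2 := by
        change t / 2 ≤ 1 / 2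
        linarith [htI.2]
      rw [h _ hle]
      convert htF using 3
      change 2 * (t / 2) = t
      ring
    have h2 : 2 * γ'.hitParam F ≤ sInf A₀ :=
      le_csInf hA₀ne fun t ht => by linarith [key t ht]
    linarith
  · -- every element of the hit set of `γ'` is at least `T / 2`
    refine le_csInf hne' ?_
    rintro s (⟨hsI, hsF⟩ | hs1)
    · by_cases hs : s ≤ 1 / 2
      · have hle : ((⟨s, hsI⟩ : I) : ℝ) ≤ 1 / 2 := hs
        rw [h _ hle] at hsF
        have hmem : 2 * s ∈ A₀ := ⟨_, hsF⟩
        have := csInf_le hA₀bdd hmem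
        linarith
      · push Not at hs
        linarith
    · rw [mem_singleton_iff.1 hs1]
      linarith

/-- **Prefix preservation.** If `γ'` runs through `γ` at double speed on `[0, 1/2]`, then for
every set `F` visited by `γ` the initial segments up to the first visit of `F` coincide:
`γ'.stopAt F = γ.stopAt F` (as parametrised curves). [folklore] -/
theorem stopAt_eq_of_prefix {γ γ' : Curve E}
    (h : ∀ t : I, ∀ ht : (t : ℝ) ≤ 1 / 2, γ' t = γ ⟨2 * t, (unitInterval.mul_pos_mem_iff zero_lt_two).2 ⟨t.2.1, ht⟩⟩)
    {F : Set E} (hF : ∃ t, γ t ∈ F) : γ'.stopAt F = γ.stopAt F := by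
  have hT := hitParam_eq_half_of_prefix h hF
  have hTI := γ.hitParam_mem_Icc F
  apply Curve.ext
  apply ContinuousMap.ext
  intro s
  change γ'.stopAt F s = γ.stopAt F s
  rw [Curve.stopAt_apply, Curve.stopAt_apply, hT]
  have hs0 : (0 : ℝ) ≤ s := s.2.1
  have hs1 : (s : ℝ) ≤ 1 := s.2.2
  have hTs : γ.hitParam F * s ∈ Icc (0 : ℝ) 1 :=
    ⟨mul_nonneg hTI.1 hs0, by nlinarith [hTI.1, hTI.2]⟩
  have hTs' : γ.hitParam F / 2 * s ∈ Icc (0 : ℝ) 1 :=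
    ⟨mul_nonneg (by linarith [hTI.1]) hs0, by nlinarith [hTI.1, hTI.2]⟩
  rw [projIcc_of_mem _ hTs, projIcc_of_mem _ hTs']
  have hle : ((⟨γ.hitParam F / 2 * s, hTs'⟩ : I) : ℝ) ≤ 1 / 2 := by
    change γ.hitParam F / 2 * s ≤ 1 / 2
    nlinarith [hTI.1, hTI.2]
  rw [h _ hle]
  congr 1
  apply Subtype.ext
  change 2 * (γ.hitParam F / 2 * s) = γ.hitParam F * s
  ring

end Append

/-! ### The filling surgery: prescribed prefix, dense range -/

/-- **Prefix-preserving filling surgery.** Let `K` be compact and star-convex at `b ∈ K` and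
`ε > 0`. There is a map `Φ` on curves such that for every curve `γ` ending at `b`: `Φ γ` runs
through `γ` at double speed on `[0, 1/2]` (so `(Φ γ).stopAt F = γ.stopAt F` for every set `F`
visited by `γ`), has the same endpoints, its trace contains that of `γ` and is contained in
`trace γ ∪ K`, and its trace passes within `ε` of every point of `K`. The weak space-filling
property of a family of curves (traces meet every open set) is thus compatible with ANY
prescribed behaviour of initial segments. [folklore] -/
theorem exists_fillingSurgery {E : Type*} [NormedAddCommGroup E] [NormedSpace ℝ E] {K : Set E}
    (hK : IsCompact K) {b : E} (hb : b ∈ K) (hKb : StarConvex ℝ b K) {ε : ℝ} (hε : 0 < ε) :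
    ∃ Φ : Curve E → Curve E, ∀ γ : Curve E, γ.target = b →
      (∀ t : I, ∀ ht : (t : ℝ) ≤ 1 / 2,
          Φ γ t = γ ⟨2 * t, (unitInterval.mul_pos_mem_iff zero_lt_two).2 ⟨t.2.1, ht⟩⟩) ∧
      (Φ γ).source = γ.source ∧ (Φ γ).target = b ∧
      γ.range ⊆ (Φ γ).range ∧ (Φ γ).range ⊆ γ.range ∪ K ∧
      (∀ z ∈ K, infDist z (Φ γ).range < ε) ∧
      ∀ F : Set E, (∃ t, γ t ∈ F) → (Φ γ).stopAt F = γ.stopAt F := by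
  classical
  obtain ⟨p, hpK, hpd⟩ := exists_loop_range_dense hK hb hKb hε
  refine ⟨fun γ => if hγ : γ.target = b then appendLoop γ (p.cast hγ hγ) else γ, fun γ hγ => ?_⟩
  simp only [dif_pos hγ]
  have hpref : ∀ t : I, ∀ ht : (t : ℝ) ≤ 1 / 2, appendLoop γ (p.cast hγ hγ) t =
      γ ⟨2 * t, (unitInterval.mul_pos_mem_iff zero_lt_two).2 ⟨t.2.1, ht⟩⟩ :=
    fun t ht => appendLoop_apply_of_le γ _ ht
  have hrange : (appendLoop γ (p.cast hγ hγ)).range = γ.range ∪ Set.range p := by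
    rw [range_appendLoop]
    rfl
  refine ⟨hpref, source_appendLoop _ _, (target_appendLoop _ _).trans hγ, ?_, ?_, ?_,
    fun F hF => stopAt_eq_of_prefix hpref hF⟩
  · rw [hrange]
    exact subset_union_left
  · rw [hrange]
    exact union_subset_union_right _ hpK
  · intro z hz
    obtain ⟨y, hy, hzy⟩ := hpd z hz
    rw [hrange]
    exact (infDist_le_dist_of_mem (mem_union_right _ hy)).trans_lt hzy

/-! ### The SAW polylines of the unit disk: same prefixes, space-filling ranges -/

section UnitDisk

variable {Ω : Set ℂ} {δ : ℝ} {a b : Site 2}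

/-- The polyline of a SAW as a parametrised curve (`γ.curve` is its class). [folklore] -/
def polylineCurve (γ : DomainSAW Ω δ a b) : Curve ℂ :=
  ⟨γ.walk.toCurve (meshPoint δ)⟩

/-- `γ.curve = [polylineCurve γ]`. [folklore] -/
theorem curve_eq_mk_polylineCurve (γ : DomainSAW Ω δ a b) :
    γ.curve = CurveClass.mk (polylineCurve γ) := rfl

/-- The polyline starts at the mesh point of `a`. [folklore] -/
@[simp] theorem source_polylineCurve (γ : DomainSAW Ω δ a b) :
    (polylineCurve γ).source = meshPoint δ a :=
  SimpleGraph.Walk.toCurve_apply_zero _ _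

/-- The polyline ends at the mesh point of `b`. [folklore] -/
@[simp] theorem target_polylineCurve (γ : DomainSAW Ω δ a b) :
    (polylineCurve γ).target = meshPoint δ b :=
  SimpleGraph.Walk.toCurve_apply_one _ _

/-- Sites of `Ω_δ` have mesh points in `Ω`. [folklore] -/
theorem meshPoint_mem_of_mem_meshDomain {v : Site 2} (hv : v ∈ meshDomain Ω δ) : meshPoint δ v ∈ Ω :=
  meshDomain_subset_meshVertices Ω δ hv

/-- **Prefix-blindness of the weak space-filling property, in the setting of Theorem 1.** In
the unit disk, for ANY lattice endpoints `A δ`, `B δ ∈ 𝔻_δ` there are curves `Y δ γ`, one for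
each SAW `γ` of `𝔻_δ` from `A δ` to `B δ`, which (i) run through the SAW polyline at double speed
on `[0, 1/2]`, hence have the same initial segment up to the first visit of every set the
polyline visits (`stopAt`), (ii) have the same endpoints and trace inside `trace ∪ 𝔻̄`, and
(iii) pass within `δ` of every point of `𝔻̄`. Under ANY family of laws on SAWs (e.g.
`lawAt x`, any `x`, in particular `x = x_c`) the laws of the `Y δ` are therefore space-filling
in `𝔻` in the weak sense of §1 while all their initial-segment laws are those of the SAW itself:
the conclusion of Theorem 1 carries no information on initial segments. [cite: DuminilCopinKozmaYadin2014, §1 and §4 ("very little additional information")] -/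
theorem exists_prefixPreserving_filling_unitDisk (A B : ℝ → Site 2)
    (hB : ∀ δ : ℝ, 0 < δ → B δ ∈ meshDomain unitDisk δ) :
    ∃ Y : ∀ δ : ℝ, DomainSAW unitDisk δ (A δ) (B δ) → Curve ℂ,
      ∀ δ : ℝ, 0 < δ → ∀ γ : DomainSAW unitDisk δ (A δ) (B δ),
        (∀ t : I, ∀ ht : (t : ℝ) ≤ 1 / 2,
            Y δ γ t = polylineCurve γ ⟨2 * t, (unitInterval.mul_pos_mem_iff zero_lt_two).2 ⟨t.2.1, ht⟩⟩) ∧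
        (Y δ γ).source = meshPoint δ (A δ) ∧ (Y δ γ).target = meshPoint δ (B δ) ∧
        (polylineCurve γ).range ⊆ (Y δ γ).range ∧
        (Y δ γ).range ⊆ (polylineCurve γ).range ∪ closedBall 0 1 ∧
        (∀ z ∈ closedBall (0 : ℂ) 1, infDist z (Y δ γ).range < δ) ∧
        ∀ F : Set ℂ, (∃ t, polylineCurve γ t ∈ F) → (Y δ γ).stopAt F = (polylineCurve γ).stopAt F := by
  classical
  have hK : IsCompact (closedBall (0 : ℂ) 1) := isCompact_closedBall 0 1
  have hbK : ∀ δ, 0 < δ → meshPoint δ (B δ) ∈ closedBall (0 : ℂ) 1 := fun δ hδ =>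
    ball_subset_closedBall (meshPoint_mem_of_mem_meshDomain (hB δ hδ))
  have hstar : ∀ δ (hδ : 0 < δ), StarConvex ℝ (meshPoint δ (B δ)) (closedBall (0 : ℂ) 1) :=
    fun δ hδ => (convex_closedBall (0 : ℂ) 1).starConvex (hbK δ hδ)
  refine ⟨fun δ γ => if hδ : 0 < δ then
      Classical.choose (exists_fillingSurgery hK (hbK δ hδ) (hstar δ hδ) hδ) (polylineCurve γ)
    else polylineCurve γ, fun δ hδ γ => ?_⟩
  simp only [dif_pos hδ]
  obtain ⟨h1, h2, h3, h4, h5, h6, h7⟩ :=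
    Classical.choose_spec (exists_fillingSurgery hK (hbK δ hδ) (hstar δ hδ) hδ) (polylineCurve γ)
      (target_polylineCurve γ)
  exact ⟨h1, h2.trans (source_polylineCurve γ), h3, h4, h5, h6, h7⟩

/-- **Consequence for laws.** With `Y` as above: for every open ball `B(z, r) ⊆ 𝔻` and every
mesh `0 < δ < r`, NO curve `Y δ γ` misses `B(z, r)` — so under any family `P δ` of laws on the
SAWs the miss probabilities are eventually `0` (the range-filling hypothesis of
`ae_subset_range_of_tendstoLaw` holds in the strongest form), while `stopAt F ∘ Y δ = stopAt F`
of the polyline surely. [cite: DuminilCopinKozmaYadin2014, §1 (When x > 1/μ)] -/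
theorem prefixBlind_unitDisk (A B : ℝ → Site 2) (hB : ∀ δ : ℝ, 0 < δ → B δ ∈ meshDomain unitDisk δ) :
    ∃ Y : ∀ δ : ℝ, DomainSAW unitDisk δ (A δ) (B δ) → Curve ℂ,
      (∀ δ : ℝ, 0 < δ → ∀ (γ : DomainSAW unitDisk δ (A δ) (B δ)) (F : Set ℂ),
          (∃ t, polylineCurve γ t ∈ F) → (Y δ γ).stopAt F = (polylineCurve γ).stopAt F) ∧
      (∀ δ : ℝ, 0 < δ → ∀ γ : DomainSAW unitDisk δ (A δ) (B δ),
          (Y δ γ).source = meshPoint δ (A δ) ∧ (Y δ γ).target = meshPoint δ (B δ) ∧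
          (Y δ γ).range ⊆ (polylineCurve γ).range ∪ closedBall 0 1) ∧
      ∀ (P : ∀ δ : ℝ, Measure (DomainSAW unitDisk δ (A δ) (B δ))) (z : ℂ) (r : ℝ), 0 < r →
        ball z r ⊆ unitDisk →
          ∀ᶠ δ in 𝓝[>] (0 : ℝ), P δ {γ | Disjoint (ball z r) (CurveClass.mk (Y δ γ)).range} = 0 := by
  obtain ⟨Y, hY⟩ := exists_prefixPreserving_filling_unitDisk A B hB
  refine ⟨Y, fun δ hδ γ F hF => (hY δ hδ γ).2.2.2.2.2.2 F hF,
    fun δ hδ γ => ⟨(hY δ hδ γ).2.1, (hY δ hδ γ).2.2.1, (hY δ hδ γ).2.2.2.2.1⟩, fun P z r hr hzr => ?_⟩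
  filter_upwards [Ioo_mem_nhdsGT hr] with δ hδ
  have hz : z ∈ closedBall (0 : ℂ) 1 := ball_subset_closedBall (hzr (mem_ball_self hr))
  have hempty : {γ : DomainSAW unitDisk δ (A δ) (B δ) |
      Disjoint (ball z r) (CurveClass.mk (Y δ γ)).range} = ∅ := by
    refine eq_empty_of_forall_notMem fun γ hγ => ?_
    have hlt : infDist z (Y δ γ).range < r := ((hY δ hδ.1 γ).2.2.2.2.2.1 z hz).trans hδ.2
    obtain ⟨y, hy, hzy⟩ := (infDist_lt_iff (Y δ γ).range_nonempty).1 hlt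
    rw [mem_setOf_eq, CurveClass.range_mk] at hγ
    exact Set.disjoint_left.1 hγ (mem_ball'.2 hzy) hy
  rw [hempty, measure_empty]

end UnitDisk


end SupercriticalSAW

open SupercriticalSAW

/-! ### The narrowed barrier -/

/-- **Barrier `SupercriticalSAWSpaceFillingProofsNarrow`** (the audited mechanism of
`SupercriticalSAWSpaceFilling`; PROVED below, `SupercriticalSAWSpaceFillingProofsNarrow_holds`):
Theorem 1 of Duminil-Copin–Kozma–Yadin (supercritical SAWs in the unit disk are space-filling)
together with the two statements delimiting what its CONCLUSION can obstruct — (A) in the curve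
topology the space-filling mechanism is exactly "limits in law of weakly space-filling SAW laws
are almost surely ONTO the domain" (so it obstructs convergence to every random curve not a.s.
onto `D`, all SLE_κ with `κ < 8`, and nothing else); (B) it is blind to initial segments: in the
unit disk, for all lattice endpoints, there are curves with the SAW polylines' initial segments
up to the first visit of every set the polyline visits, the same endpoints, traces within
`trace ∪ 𝔻̄`, and `δ`-dense in `𝔻̄` — for every SAW and every mesh `δ > 0`.

BARRIER (structured block, D-0021):
- technique_class: delta-independent-fugacity-neighbourhood conclusion-robust-in-x ON THE LAW OF THE TRACE (`SupercriticalSAW.RobustSAWScalingLimit`, `SupercriticalSAW.WindowRobustSAWScalingLimit w` with `w ≥ η > 0`: an SLE_{8/3} — or any non-space-filling — limit IN LAW OF THE UNPARAMETRISED CURVE, metric `d` of [cite: LawlerSchrammWerner2004SAW, §3.4.1], or of its trace in the Hausdorff metric `d_H ≤ d` [cite: LawlerSchrammWerner2004SAW, §3.4.1], asserted for all fugacities of a δ-independent neighbourhood or right-neighbourhood of `x_c`) [cite: DuminilCopinKozmaYadin2014, Theorem 1]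
- blocks: `RobustSAWScalingLimit` and the window versions of `SupercriticalSAWSpaceFillingNarrow` (unchanged), and, sharply (`SupercriticalSAW.ae_subset_range_of_tendstoLaw`, `SupercriticalSAW.IsSpaceFillingLaws.not_convergesInLawToSLE_of_not_ae_onto`, proved here): convergence in law in the curve topology of ANY weakly space-filling family of SAW laws — the fugacity-`x` laws in `𝔻` for each fixed `x > 1/μ` [cite: DuminilCopinKozmaYadin2014, Theorem 1] — to ANY random curve that is not almost surely onto the domain; this covers chordal SLE_κ for every `κ < 8` (trace of Hausdorff dimension at most `1 + κ/8 < 2` [cite: RohdeSchramm2005, Thm 8.1 (arXiv Cor. 25)], with equality [cite: Beffara2008, Thm 1]) and is void for `κ ≥ 8` (space-filling [cite: RohdeSchramm2005, §1]), in agreement with the conjectured SLE₈ limit for `x > 1/μ` [cite: DuminilCopinKozmaYadin2014, Conjecture 11]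
- because: one-sided portmanteau with the bounded `1/r`-Lipschitz functionals `F_{z,r}(c) = g_r(dist(z, trace c))` over countably many balls `B(z,r) ⊆ D`: `∫ F_{z,r} dP_δ ≤ P_δ[trace misses B(z,r)] → 0` [cite: DuminilCopinKozmaYadin2014, §1 (When x > 1/μ)] forces `F_{z,r}(Γ) = 0` almost surely in the limit, i.e. `dist(z, trace Γ) ≤ r`; traces are compact, so a.s. `D ⊆ trace Γ`
- evasions_known: (i)–(iii) of `SupercriticalSAWSpaceFillingNarrow` (mesh-coordinated windows `x(δ) → x_c`; hypotheses or identities open in `x`; the missing closed formula for `μ(ℤ²)`); (iv) NEW — TIME ORDER / INITIAL SEGMENTS: Theorem 1 and the weak space-filling property are statements about the law of the final trace; by the filling surgery (`SupercriticalSAW.exists_fillingSurgery`, `SupercriticalSAW.prefixBlind_unitDisk`, proved here) a family of curves with exactly the SAW's laws of initial segments (curve stopped at the first visit of any closed set it visits, e.g. `B̄(b_δ, ρ)` for every `ρ > 0`) under ANY laws, in particular the critical ones, is surely space-filling at scale `δ`; since the chordal Loewner chain in `(D; a, b)` up to any finite half-plane capacity is a functional of the curve stopped near `b`, conclusions about driving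 functions on compact time intervals — equivalently Carathéodory convergence of the chains [cite: Lawler2005, §4.7, Prop. 4.47], a topology in which every chain is a limit of simple-curve chains [cite: Lawler2005, §4.7, Prop. 4.48] — about observables evaluated before disconnection, or about local limits at the starting point are not obstructed by Theorem 1, however robust in `x` they are; turning driving convergence into curve convergence needs a crossing condition [cite: KemppainenSmirnov2017, §1 and Cor. 1.5] which space-filling families violate [cite: KemppainenSmirnov2017, §4.5]; the source: "We know that the curve becomes space-filling, yet we have very little additional information" [cite: DuminilCopinKozmaYadin2014, §4] — only Conjecture 11 (SLE₈, driving function `√8 B`) or a progressive-filling theorem for `x > 1/μ`, neither in print, would close this gap; (v) canonical ensembles carry no fugacity: the half-plane infinite SAW is a weak limit of UNIFORM measures [cite: LawlerSchrammWerner2004SAW, §3.4.6 and Appendix], its SLE_{8/3} limit is Prediction 1 [cite: LawlerSchrammWerner2004SAW, Prediction 1 (§4.1)], and `μ` enters once, exactly, through Kesten's relation `Σ λ_n β^{-n} = 1` [cite: LawlerSchrammWerner2004SAW, Appendix]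
- scope_caveats: those of `SupercriticalSAWSpaceFillingNarrow`; in addition the obstruction is to conclusions that determine the law of the TRACE (curve topology `d`, Hausdorff topology `d_H`) — prefix-level, driving-function, capacity-parametrised and local statements are outside (evasion (iv)), as are fixed-length and half-plane kinetic ensembles until their final conversion to the `x_c`-ensemble (evasion (v)); the curves `Y δ γ` of (B) are not lattice self-avoiding paths and assert nothing about the actual supercritical walk, whose prefixes are conjecturally SLE₈-like and progressively filling [cite: DuminilCopinKozmaYadin2014, Conjecture 11] — the narrowing is about what the printed CONCLUSION of Theorem 1 can refute; on the subcritical side (`x < 1/μ`, where the source is "not aware of a reference for the details" [cite: DuminilCopinKozmaYadin2014, §1]) the straight-line / Brownian-bridge limit of the step-weighted walk between opposite ends of a box is recorded as "implicit in" Chayes–Chayes and Ioffe and "worked out" in Kovchegov's 2002 thesis [cite: BetzTaggi2016, §1], so left-neighbourhood-robust SLE_{8/3} conclusions are refuted as well (thesis level, box domains)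
- status: established (proved in the tree: `SupercriticalSAWSpaceFillingProofsNarrow_holds`)

[cite: DuminilCopinKozmaYadin2014, Theorem 1] -/
def SupercriticalSAWSpaceFillingProofsNarrow : Prop :=
  SupercriticalSAWSpaceFilling ∧
    (∀ (D : DobrushinDomain) (A B : ℝ → Site 2)
        (P : ∀ δ : ℝ, Measure (DomainSAW D.carrier δ (A δ) (B δ))),
        (∀ δ, IsFiniteMeasure (P δ)) → IsSpaceFillingLaws D.carrier A B P →
          ∀ (W : Measure (ℝ≥0 → ℝ)) (Γ : (ℝ≥0 → ℝ) → CurveClass ℂ), IsFiniteMeasure W →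
            AEMeasurable Γ W →
              TendstoLaw (fun δ (γ : DomainSAW D.carrier δ (A δ) (B δ)) => γ.curve) P Γ W →
                ∀ᵐ ω ∂W, D.carrier ⊆ (Γ ω).range) ∧
    ∀ A B : ℝ → Site 2, (∀ δ : ℝ, 0 < δ → B δ ∈ meshDomain unitDisk δ) →
      ∃ Y : ∀ δ : ℝ, DomainSAW unitDisk δ (A δ) (B δ) → Curve ℂ,
        ∀ δ : ℝ, 0 < δ → ∀ γ : DomainSAW unitDisk δ (A δ) (B δ),
          (∀ F : Set ℂ, (∃ t, polylineCurve γ t ∈ F) →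
              (Y δ γ).stopAt F = (polylineCurve γ).stopAt F) ∧
            (Y δ γ).source = meshPoint δ (A δ) ∧ (Y δ γ).target = meshPoint δ (B δ) ∧
            (Y δ γ).range ⊆ (polylineCurve γ).range ∪ closedBall 0 1 ∧
            ∀ z ∈ closedBall (0 : ℂ) 1, infDist z (Y δ γ).range < δ

/-- **The narrowed barrier holds**: Theorem 1 is `SupercriticalSAWSpaceFilling_holds`
(`…TilesTheorem6`), (A) is `IsSpaceFillingLaws.ae_carrier_subset_range`, (B) is
`exists_prefixPreserving_filling_unitDisk`. [cite: DuminilCopinKozmaYadin2014, Theorem 1] -/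
theorem SupercriticalSAWSpaceFillingProofsNarrow_holds : SupercriticalSAWSpaceFillingProofsNarrow := by
  refine ⟨SupercriticalSAWSpaceFilling_holds, ?_, ?_⟩
  · intro D A B P hP hfill W Γ hW hΓ hT
    exact hfill.ae_carrier_subset_range hΓ hT
  · intro A B hB
    obtain ⟨Y, hY⟩ := exists_prefixPreserving_filling_unitDisk A B hB
    refine ⟨Y, fun δ hδ γ => ?_⟩
    obtain ⟨-, h2, h3, -, h5, h6, h7⟩ := hY δ hδ γ
    exact ⟨h7, h2, h3, h5, h6⟩

end Literature.Barriers.CriticalPhenomena
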